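import Summits.CriticalPhenomena.PercolationContinuityZ3.Theses.PercSieveRigidity
import Summits.CriticalPhenomena.PercolationContinuityZ3.Theorems.PercNearOneGluingNoHeavyLowerTailCSHTheoremOne
import Literature.Probability.Percolation.PercolationProofs
import Literature.Probability.Percolation.SharpnessDCTProofs
import HarnessLib

/-!
# `PercSieveRigidity.BernoulliExitLaw` (stmt-CriticalPhenomena-8321) — SETTLED after continuity

Item `stmt-CriticalPhenomena-8321` of route `CriticalPhenomena/PercSieveRigidity` (support): the exit law for Bernoulli(p_c): `P_{p_c}(|C(0)| = ∞ and U_k ≤ M) → 0` for every direction `i` and `M`.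

With `θ(p_c(ℤ³)) = 0` (p205010) the event `{|C(0)| = ∞}` is `P_{p_c}`-null, so every term of the sequence is `0` (squeeze); the hypothesis `StrictPlugSieve` is not used.

builds on p205010 (kernel theorem, internal audit signed; external expert review pending) — USED (`CSH.percolationContinuityZ3_holds`).  RSW3 lane, lead gen 28 (prover-prim-rsw3-lead-g28-0):
'after continuity — the ledger harvest'.
References: G. Kozma, N. Nitzan (2024), Thm. 6 / Conj. 3 [KozmaNitzan2024]; G. Grimmett, *Percolation* (1999), §8 [GrimmettPercolation1999].
-/

noncomputable section

namespace Summit.CriticalPhenomena.PercolationContinuityZ3.Theorems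

namespace PercSieveRigidityBernoulliExitLaw

open MeasureTheory Literature.Probability.Percolation Literature.Probability.LatticeModels
open Filter Topology

/-- **`PercSieveRigidity.BernoulliExitLaw` (stmt-CriticalPhenomena-8321), settled.**  `0 ≤ P({|C(0)| = ∞} ∩ ·) ≤ θ(p_c) = 0` for every `k` (p205010).
[cite: KozmaNitzan2024, Thm. 6 with Conj. 3 (p. 15)] -/
theorem bernoulliExitLaw_proof : Summit.CriticalPhenomena.PercolationContinuityZ3.Theses.PercSieveRigidity.BernoulliExitLaw := by
  unfold Summit.CriticalPhenomena.PercolationContinuityZ3.Theses.PercSieveRigidity.BernoulliExitLaw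
  intro _ i M
  have h0 : (bondPercolation (zdGraph 3) (criticalProbI 3)).real (percolatesAt (0 : Site 3)) = 0 :=
    CSH.percolationContinuityZ3_holds
  refine tendsto_of_tendsto_of_tendsto_of_le_of_le tendsto_const_nhds tendsto_const_nhds
    (fun k => measureReal_nonneg) (fun k => ?_)
  exact (measureReal_mono Set.inter_subset_left (measure_ne_top _ _)).trans (le_of_eq h0)

end PercSieveRigidityBernoulliExitLaw

end Summit.CriticalPhenomena.PercolationContinuityZ3.Theorems

end
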